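import Literature.InformationTheory.Entanglement.Negativity
import HarnessLib

/-!
# The negativity does not increase under local measurements: `Σ_i p_i 𝒩(ρ'_i) ≤ 𝒩(ρ)` for
# `p_iρ'_i = (𝟙 ⊗ M_i)ρ(𝟙 ⊗ M_i)^†`, `Σ_i M_i^†M_i ≤ 𝟙` (Vidal–Werner 2002, § II.B, Proposition 3)

Hodge foundations lane (`lit-hodgefound`, prover p24 gen 77; quantum-information series, sequel of `Negativity.lean`).
THEOREMS ONLY: no definition, no named fact, net debt 0; `𝒩(A) = Σ_i λ_i(A)⁻` (the sum of the absolute values of the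
negative eigenvalues), which is positively homogeneous, so `p_i𝒩(ρ'_i) = 𝒩(p_iρ'_i) = 𝒩(𝒯_i(ρ))` and Proposition 3 is
stated for the unnormalised outputs `𝒯_i(ρ)`.

## Source, VERBATIM — G. Vidal, R. F. Werner, *Computable measure of entanglement*, Phys. Rev. A **65** (2002) 032314
[VidalWerner2002], § II.B (held `paper:arxiv-quant-ph_0102117`, chunk p0006)

«… it suffices to consider just one local measurement by Bob. Now the most general local measurement is described by a
family `𝒯_i` of completely positive linear maps such that … `𝒯_i(ρ) = p_iρ'_i`. These maps satisfy the normalization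
condition `Σ_i tr(𝒯_i(ρ)) = tr(ρ)`. … we can assume … that `𝒯_i` is “pure” … we can write
`𝒯_i(ρ) = (𝟙_A ⊗ M_i) ρ (𝟙_A ⊗ M_i^†)`, (15) where the Kraus operators `M_i` must satisfy the normalization condition
`Σ_i M_i^†M_i ≤ I_B`. For computing the right hand side of Eq. (13) we need that `𝒯_i(ρ)^{T_A} = 𝒯_i(ρ^{T_A})`, (16)
which immediately follows from (15) … A similar formula holds for Alice's local operations, but with a modified operation
`𝒯_i` on the right hand side, in which the Kraus operators have been replaced by their complex conjugates.
Consider the decomposition `ρ^{T_A} = (1+N)ρ⁺ − Nρ⁻` with density operators `ρ^±` and `N = 𝒩(ρ)`. Then we can also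
decompose the partially transposed output states: `p_i(ρ'_i)^{T_A} = 𝒯_i(ρ)^{T_A} = 𝒯_i(ρ^{T_A}) = (1+N)𝒯_i(ρ⁺) − N𝒯_i(ρ⁻)`.
Dividing by `p_i` we get a decomposition of precisely the sort (7) defining `𝒩(ρ'_i)`. The coefficient `a_− = N/p_i` must
be larger than the infimum, i.e., `𝒩(ρ'_i) ≤ N/p_i`.»  [The printed last step is completed by summing
`p_i𝒩(ρ'_i) ≤ N·tr 𝒯_i(ρ⁻)` over `i` and using `Σ_i tr 𝒯_i(ρ⁻) = tr((𝟙 ⊗ Σ_i M_i^†M_i)ρ⁻) ≤ 1`.]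
«**Proposition 3:** `𝒩(ρ) ≥ Σ_i p_i 𝒩(ρ'_i)` — `𝒩` is an entanglement monotone.»

## What is formalized (all PROVED)

* (16) `ptA_localKraus_right` (`((𝟙 ⊗ M)ρ(𝟙 ⊗ M)^†)^{T_A} = (𝟙 ⊗ M)ρ^{T_A}(𝟙 ⊗ M)^†`) and `ptA_localKraus_left`
  (Alice: `((M ⊗ 𝟙)ρ(M ⊗ 𝟙)^†)^{T_A} = (M̄ ⊗ 𝟙)ρ^{T_A}(M̄ ⊗ 𝟙)^†`);
* the trace bookkeeping `sum_re_trace_localKraus_right_le` / `_left_le` (`Σ_i tr 𝒯_i(Q) ≤ tr Q` for `Q ⪰ 0`);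
* **Proposition 3** for one local measurement: **`sum_negPart_eigenvalues_ptA_localKraus_right_le`** (Bob) and
  **`sum_negPart_eigenvalues_ptA_localKraus_left_le`** (Alice): `Σ_i 𝒩(𝒯_i(ρ)^{T_A}) ≤ 𝒩(ρ^{T_A})`; the single-outcome
  case `sum_negPart_eigenvalues_ptA_localConj_le` (`𝒩(((𝟙 ⊗ M)ρ(𝟙 ⊗ M)^†)^{T_A}) ≤ 𝒩(ρ^{T_A})` for `M^†M ≤ 𝟙`).

NOT formalized: the iteration over rounds / the classical bookkeeping of a general LOCC protocol, and the reduction of a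
general instrument to single-Kraus («pure») maps (it uses the convexity `Negativity.sum_negPart_eigenvalues_convex`).
Kraus operators are taken square (`M_i : Matrix n n ℂ`).  -- TODO(general form): rectangular `M_i : Matrix n' n ℂ`.

## Tree search (2026-08-31)

`rg -n "Kraus" Literature/InformationTheory/Entanglement` → channel files (`QuantumChannels/…`), nothing on `𝒩`; REUSED:
`Negativity.{exists_jordan_decomposition, sum_negPart_eigenvalues_le_trace}`, `PPTOverlap.{ptA_localConj,
trace_mul_nonneg_of_posSemidef}`, Mathlib `PosSemidef.kronecker`, `PosSemidef.mul_mul_conjTranspose_same`.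

presearch: «negativity monotone LOCC local measurement Kraus operators partial transpose commutes with local operation on
Bob» → [corpus: arxiv quant-ph/0102117 § II.B Prop. 3] [corpus: bertlmann2023 § 16.3.3 («shown in Vidal and Werner (2002)
that 𝒩(ρ) is monotonic under LOCC»)]; galaxy `"negativity|entanglement monotone"` (pdf) → Plenio 2005 (log-negativity),
Vidal 2000 (monotones).

## References

* [VidalWerner2002] § II.B, eqs. (13)–(17), Proposition 3.
-/

noncomputable section

open Matrix Finset
open scoped ComplexOrder Kronecker

namespace Literature.InformationTheory.Entanglement.NegativityLocalMonotone

open Literature.InformationTheory.Entanglement.PPT (ptA)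
open Literature.InformationTheory.Entanglement.PPTOverlap (ptA_localConj trace_mul_nonneg_of_posSemidef)
open Literature.InformationTheory.Entanglement.Negativity (exists_jordan_decomposition sum_negPart_eigenvalues_le_trace)

variable {m n ι : Type*} [Fintype m] [Fintype n] [DecidableEq m] [DecidableEq n] [Fintype ι]

/-! ## § 1. (16): a local operation commutes with `T_A` -/

/-- **(16), Bob: `((𝟙 ⊗ M)ρ(𝟙 ⊗ M)^†)^{T_A} = (𝟙 ⊗ M)ρ^{T_A}(𝟙 ⊗ M)^†`.** [cite: VidalWerner2002, § II.B eq. (16)] -/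
theorem ptA_localKraus_right (M : Matrix n n ℂ) (ρ : Matrix (m × n) (m × n) ℂ) :
    ptA (((1 : Matrix m m ℂ) ⊗ₖ M) * ρ * ((1 : Matrix m m ℂ) ⊗ₖ M)ᴴ) =
      ((1 : Matrix m m ℂ) ⊗ₖ M) * ptA ρ * ((1 : Matrix m m ℂ) ⊗ₖ M)ᴴ := by
  rw [ptA_localConj, Matrix.map_one star (star_zero ℂ) (star_one ℂ)]

/-- **(16), Alice («the Kraus operators have been replaced by their complex conjugates»):
`((M ⊗ 𝟙)ρ(M ⊗ 𝟙)^†)^{T_A} = (M̄ ⊗ 𝟙)ρ^{T_A}(M̄ ⊗ 𝟙)^†`.** [cite: VidalWerner2002, § II.B (after eq. (16))] -/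
theorem ptA_localKraus_left (M : Matrix m m ℂ) (ρ : Matrix (m × n) (m × n) ℂ) :
    ptA ((M ⊗ₖ (1 : Matrix n n ℂ)) * ρ * (M ⊗ₖ (1 : Matrix n n ℂ))ᴴ) =
      (M.map star ⊗ₖ (1 : Matrix n n ℂ)) * ptA ρ * (M.map star ⊗ₖ (1 : Matrix n n ℂ))ᴴ :=
  ptA_localConj M 1 ρ

/-! ## § 2. `Σ_i tr 𝒯_i(Q) ≤ tr Q` for `Q ⪰ 0` and `Σ_i M_i^†M_i ≤ 𝟙` -/

omit [Fintype m] [Fintype n] [DecidableEq n] [Fintype ι] in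
/-- `Σ_i 𝟙 ⊗ N_i = 𝟙 ⊗ Σ_i N_i`. [folklore] -/
private theorem sum_one_kronecker (s : Finset ι) (N : ι → Matrix n n ℂ) :
    ∑ i ∈ s, (1 : Matrix m m ℂ) ⊗ₖ N i = (1 : Matrix m m ℂ) ⊗ₖ ∑ i ∈ s, N i := by
  ext ⟨a, b⟩ ⟨c, d⟩
  simp only [Matrix.sum_apply, kroneckerMap_apply, Finset.mul_sum]

omit [Fintype m] [Fintype n] [DecidableEq m] [Fintype ι] in
/-- `Σ_i N_i ⊗ 𝟙 = (Σ_i N_i) ⊗ 𝟙`. [folklore] -/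
private theorem sum_kronecker_one (s : Finset ι) (N : ι → Matrix m m ℂ) :
    ∑ i ∈ s, N i ⊗ₖ (1 : Matrix n n ℂ) = (∑ i ∈ s, N i) ⊗ₖ (1 : Matrix n n ℂ) := by
  ext ⟨a, b⟩ ⟨c, d⟩
  simp only [Matrix.sum_apply, kroneckerMap_apply, Finset.sum_mul]

/-- **`Σ_i tr((𝟙 ⊗ M_i)Q(𝟙 ⊗ M_i)^†) ≤ tr Q`** for `Q ⪰ 0` and `Σ_i M_i^†M_i ≤ 𝟙` (the normalization of a local
measurement). [cite: VidalWerner2002, § II.B («the Kraus operators `M_i` must satisfy the normalization condition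
`Σ_i M_i^†M_i ≤ I_B`»)] -/
theorem sum_re_trace_localKraus_right_le (M : ι → Matrix n n ℂ)
    (hM : ((1 : Matrix n n ℂ) - ∑ i, (M i)ᴴ * M i).PosSemidef) {Q : Matrix (m × n) (m × n) ℂ} (hQ : Q.PosSemidef) :
    ∑ i, ((((1 : Matrix m m ℂ) ⊗ₖ M i) * Q * ((1 : Matrix m m ℂ) ⊗ₖ M i)ᴴ).trace).re ≤ Q.trace.re := by
  have hterm : ∀ i, (((1 : Matrix m m ℂ) ⊗ₖ M i) * Q * ((1 : Matrix m m ℂ) ⊗ₖ M i)ᴴ).trace =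
      (((1 : Matrix m m ℂ) ⊗ₖ ((M i)ᴴ * M i)) * Q).trace := by
    intro i
    rw [Matrix.mul_assoc, trace_mul_comm, Matrix.mul_assoc, trace_mul_comm Q, conjTranspose_kronecker,
      ← mul_kronecker_mul, conjTranspose_one, Matrix.one_mul]
  have hsum : ∑ i, ((((1 : Matrix m m ℂ) ⊗ₖ M i) * Q * ((1 : Matrix m m ℂ) ⊗ₖ M i)ᴴ).trace).re =
      ((((1 : Matrix m m ℂ) ⊗ₖ ∑ i, (M i)ᴴ * M i) * Q).trace).re := by
    rw [← Complex.re_sum]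
    congr 1
    rw [← sum_one_kronecker, Finset.sum_mul, trace_sum]
    exact Finset.sum_congr rfl fun i _ => hterm i
  rw [hsum, ← sub_nonneg, ← Complex.sub_re, ← trace_sub]
  have hdiff : Q - ((1 : Matrix m m ℂ) ⊗ₖ ∑ i, (M i)ᴴ * M i) * Q =
      ((1 : Matrix m m ℂ) ⊗ₖ ((1 : Matrix n n ℂ) - ∑ i, (M i)ᴴ * M i)) * Q := by
    rw [show (1 : Matrix m m ℂ) ⊗ₖ ((1 : Matrix n n ℂ) - ∑ i, (M i)ᴴ * M i) =
        (1 : Matrix (m × n) (m × n) ℂ) - (1 : Matrix m m ℂ) ⊗ₖ ∑ i, (M i)ᴴ * M i by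
          ext ⟨a, b⟩ ⟨c, d⟩
          simp only [kroneckerMap_apply, Matrix.sub_apply, one_apply, Prod.mk.injEq]
          split_ifs <;> simp_all,
      Matrix.sub_mul, Matrix.one_mul]
  rw [hdiff]
  exact (Complex.nonneg_iff.1 (trace_mul_nonneg_of_posSemidef (PosSemidef.one.kronecker hM) hQ)).1

/-- **`Σ_i tr((M_i ⊗ 𝟙)Q(M_i ⊗ 𝟙)^†) ≤ tr Q`** for `Q ⪰ 0` and `Σ_i M_i^†M_i ≤ 𝟙` (Alice's side).
[cite: VidalWerner2002, § II.B] -/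
theorem sum_re_trace_localKraus_left_le (M : ι → Matrix m m ℂ)
    (hM : ((1 : Matrix m m ℂ) - ∑ i, (M i)ᴴ * M i).PosSemidef) {Q : Matrix (m × n) (m × n) ℂ} (hQ : Q.PosSemidef) :
    ∑ i, (((M i ⊗ₖ (1 : Matrix n n ℂ)) * Q * (M i ⊗ₖ (1 : Matrix n n ℂ))ᴴ).trace).re ≤ Q.trace.re := by
  have hterm : ∀ i, ((M i ⊗ₖ (1 : Matrix n n ℂ)) * Q * (M i ⊗ₖ (1 : Matrix n n ℂ))ᴴ).trace =
      ((((M i)ᴴ * M i) ⊗ₖ (1 : Matrix n n ℂ)) * Q).trace := by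
    intro i
    rw [Matrix.mul_assoc, trace_mul_comm, Matrix.mul_assoc, trace_mul_comm Q, conjTranspose_kronecker,
      ← mul_kronecker_mul, conjTranspose_one, Matrix.one_mul]
  have hsum : ∑ i, (((M i ⊗ₖ (1 : Matrix n n ℂ)) * Q * (M i ⊗ₖ (1 : Matrix n n ℂ))ᴴ).trace).re =
      ((((∑ i, (M i)ᴴ * M i) ⊗ₖ (1 : Matrix n n ℂ)) * Q).trace).re := by
    rw [← Complex.re_sum]
    congr 1
    rw [← sum_kronecker_one, Finset.sum_mul, trace_sum]
    exact Finset.sum_congr rfl fun i _ => hterm i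
  rw [hsum, ← sub_nonneg, ← Complex.sub_re, ← trace_sub]
  have hdiff : Q - ((∑ i, (M i)ᴴ * M i) ⊗ₖ (1 : Matrix n n ℂ)) * Q =
      ((((1 : Matrix m m ℂ) - ∑ i, (M i)ᴴ * M i)) ⊗ₖ (1 : Matrix n n ℂ)) * Q := by
    rw [show (((1 : Matrix m m ℂ) - ∑ i, (M i)ᴴ * M i)) ⊗ₖ (1 : Matrix n n ℂ) =
        (1 : Matrix (m × n) (m × n) ℂ) - (∑ i, (M i)ᴴ * M i) ⊗ₖ (1 : Matrix n n ℂ) by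
          ext ⟨a, b⟩ ⟨c, d⟩
          simp only [kroneckerMap_apply, Matrix.sub_apply, one_apply, Prod.mk.injEq]
          split_ifs <;> simp_all,
      Matrix.sub_mul, Matrix.one_mul]
  rw [hdiff]
  exact (Complex.nonneg_iff.1 (trace_mul_nonneg_of_posSemidef (hM.kronecker PosSemidef.one) hQ)).1

/-! ## § 3. Proposition 3 for one local measurement -/

/-- The core step: if `X = P − Q` with `P, Q ⪰ 0`, then `Σ_i 𝒩(K_iXK_i^†) ≤ Σ_i tr(K_iQK_i^†)` («a decomposition of
precisely the sort (7) defining `𝒩(ρ'_i)`»). [cite: VidalWerner2002, § II.B (proof of Prop. 3)] -/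
theorem sum_negPart_eigenvalues_conj_le_sum_trace {k : Type*} [Fintype k] [DecidableEq k] (K : ι → Matrix k k ℂ)
    {X P Q : Matrix k k ℂ} (hP : P.PosSemidef) (hQ : Q.PosSemidef) (hX : X = P - Q)
    (hH : ∀ i, (K i * X * (K i)ᴴ).IsHermitian) :
    ∑ i, ∑ j, ((hH i).eigenvalues j)⁻ ≤ ∑ i, ((K i * Q * (K i)ᴴ).trace).re := by
  refine Finset.sum_le_sum fun i _ => ?_
  exact sum_negPart_eigenvalues_le_trace (hH i) (hP.mul_mul_conjTranspose_same (K i))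
    (hQ.mul_mul_conjTranspose_same (K i)) (by rw [hX, Matrix.mul_sub, Matrix.sub_mul])

/-- **Proposition 3 (one local measurement by Bob): `Σ_i 𝒩(𝒯_i(ρ)^{T_A}) ≤ 𝒩(ρ^{T_A})`** for
`𝒯_i(ρ) = (𝟙 ⊗ M_i)ρ(𝟙 ⊗ M_i)^†` with `Σ_i M_i^†M_i ≤ 𝟙`; since `𝒩(p_iρ'_i) = p_i𝒩(ρ'_i)` this is
`𝒩(ρ) ≥ Σ_i p_i𝒩(ρ'_i)`. [cite: VidalWerner2002, § II.B Proposition 3] -/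
theorem sum_negPart_eigenvalues_ptA_localKraus_right_le (M : ι → Matrix n n ℂ)
    (hM : ((1 : Matrix n n ℂ) - ∑ i, (M i)ᴴ * M i).PosSemidef) {ρ : Matrix (m × n) (m × n) ℂ}
    (hH : (ptA ρ).IsHermitian)
    (hHi : ∀ i, (ptA (((1 : Matrix m m ℂ) ⊗ₖ M i) * ρ * ((1 : Matrix m m ℂ) ⊗ₖ M i)ᴴ)).IsHermitian) :
    ∑ i, ∑ j, ((hHi i).eigenvalues j)⁻ ≤ ∑ j, (hH.eigenvalues j)⁻ := by
  -- `ρ^{T_A} = P − Q`, `tr Q = 𝒩(ρ^{T_A})`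
  obtain ⟨P, Q, hP, hQ, hdec, -, -, hQtr⟩ := exists_jordan_decomposition hH
  -- transport the witnesses along (16)
  have hHi' : ∀ i, (((1 : Matrix m m ℂ) ⊗ₖ M i) * ptA ρ * ((1 : Matrix m m ℂ) ⊗ₖ M i)ᴴ).IsHermitian := by
    intro i; rw [← ptA_localKraus_right]; exact hHi i
  have key : ∀ (X Y : Matrix (m × n) (m × n) ℂ) (hX : X.IsHermitian) (hY : Y.IsHermitian), X = Y →
      ∑ j, (hX.eigenvalues j)⁻ = ∑ j, (hY.eigenvalues j)⁻ := by
    rintro X Y hX hY rfl; rfl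
  calc ∑ i, ∑ j, ((hHi i).eigenvalues j)⁻ = ∑ i, ∑ j, ((hHi' i).eigenvalues j)⁻ :=
        Finset.sum_congr rfl fun i _ => key _ _ (hHi i) (hHi' i) (ptA_localKraus_right (M i) ρ)
    _ ≤ ∑ i, ((((1 : Matrix m m ℂ) ⊗ₖ M i) * Q * ((1 : Matrix m m ℂ) ⊗ₖ M i)ᴴ).trace).re :=
        sum_negPart_eigenvalues_conj_le_sum_trace _ hP hQ hdec hHi'
    _ ≤ Q.trace.re := sum_re_trace_localKraus_right_le M hM hQ
    _ = ∑ j, (hH.eigenvalues j)⁻ := hQtr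

/-- **Proposition 3 (one local measurement by Alice): `Σ_i 𝒩(𝒯_i(ρ)^{T_A}) ≤ 𝒩(ρ^{T_A})`** for
`𝒯_i(ρ) = (M_i ⊗ 𝟙)ρ(M_i ⊗ 𝟙)^†`, `Σ_i M_i^†M_i ≤ 𝟙` (via the conjugate Kraus operators `M̄_i`).
[cite: VidalWerner2002, § II.B Proposition 3 («A similar formula holds for Alice's local operations»)] -/
theorem sum_negPart_eigenvalues_ptA_localKraus_left_le (M : ι → Matrix m m ℂ)
    (hM : ((1 : Matrix m m ℂ) - ∑ i, (M i)ᴴ * M i).PosSemidef) {ρ : Matrix (m × n) (m × n) ℂ}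
    (hH : (ptA ρ).IsHermitian)
    (hHi : ∀ i, (ptA ((M i ⊗ₖ (1 : Matrix n n ℂ)) * ρ * (M i ⊗ₖ (1 : Matrix n n ℂ))ᴴ)).IsHermitian) :
    ∑ i, ∑ j, ((hHi i).eigenvalues j)⁻ ≤ ∑ j, (hH.eigenvalues j)⁻ := by
  obtain ⟨P, Q, hP, hQ, hdec, -, -, hQtr⟩ := exists_jordan_decomposition hH
  have hHi' : ∀ i, (((M i).map star ⊗ₖ (1 : Matrix n n ℂ)) * ptA ρ * ((M i).map star ⊗ₖ (1 : Matrix n n ℂ))ᴴ).IsHermitian := by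
    intro i; rw [← ptA_localKraus_left]; exact hHi i
  -- the conjugate Kraus family is normalised as well: `Σ M̄_i^† M̄_i = (Σ M_i^†M_i)‾ ≤ 𝟙`
  have hMbar : ((1 : Matrix m m ℂ) - ∑ i, ((M i).map star)ᴴ * (M i).map star).PosSemidef := by
    have heq : (1 : Matrix m m ℂ) - ∑ i, ((M i).map star)ᴴ * (M i).map star =
        ((1 : Matrix m m ℂ) - ∑ i, (M i)ᴴ * M i)ᵀ := by
      ext a b
      simp only [Matrix.sub_apply, transpose_apply, Matrix.sum_apply, mul_apply, conjTranspose_apply, Matrix.map_apply,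
        star_star, one_apply]
      congr 1
      · by_cases h : a = b
        · subst h; rfl
        · rw [if_neg h, if_neg (Ne.symm h)]
      · exact Finset.sum_congr rfl fun i _ => Finset.sum_congr rfl fun c _ => mul_comm _ _
    rw [heq]; exact hM.transpose
  have key : ∀ (X Y : Matrix (m × n) (m × n) ℂ) (hX : X.IsHermitian) (hY : Y.IsHermitian), X = Y →
      ∑ j, (hX.eigenvalues j)⁻ = ∑ j, (hY.eigenvalues j)⁻ := by
    rintro X Y hX hY rfl; rfl
  calc ∑ i, ∑ j, ((hHi i).eigenvalues j)⁻ = ∑ i, ∑ j, ((hHi' i).eigenvalues j)⁻ :=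
        Finset.sum_congr rfl fun i _ => key _ _ (hHi i) (hHi' i) (ptA_localKraus_left (M i) ρ)
    _ ≤ ∑ i, ((((M i).map star ⊗ₖ (1 : Matrix n n ℂ)) * Q * ((M i).map star ⊗ₖ (1 : Matrix n n ℂ))ᴴ).trace).re :=
        sum_negPart_eigenvalues_conj_le_sum_trace _ hP hQ hdec hHi'
    _ ≤ Q.trace.re := sum_re_trace_localKraus_left_le (fun i => (M i).map star) hMbar hQ
    _ = ∑ j, (hH.eigenvalues j)⁻ := hQtr

/-- **One outcome: `𝒩(((𝟙 ⊗ M)ρ(𝟙 ⊗ M)^†)^{T_A}) ≤ 𝒩(ρ^{T_A})` whenever `M^†M ≤ 𝟙`** (e.g. a local unitary, where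
equality holds by symmetry, or a local filter). [cite: VidalWerner2002, § II.B Proposition 3 (the case of a single `i`:
«`𝒩(ρ'_i) ≤ N/p_i`»)] -/
theorem sum_negPart_eigenvalues_ptA_localConj_le (M : Matrix n n ℂ) (hM : ((1 : Matrix n n ℂ) - Mᴴ * M).PosSemidef)
    {ρ : Matrix (m × n) (m × n) ℂ} (hH : (ptA ρ).IsHermitian)
    (hH' : (ptA (((1 : Matrix m m ℂ) ⊗ₖ M) * ρ * ((1 : Matrix m m ℂ) ⊗ₖ M)ᴴ)).IsHermitian) :
    ∑ j, (hH'.eigenvalues j)⁻ ≤ ∑ j, (hH.eigenvalues j)⁻ := by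
  have h := sum_negPart_eigenvalues_ptA_localKraus_right_le (ι := Unit) (fun _ => M)
    (by rwa [Fintype.sum_unique]) hH (fun _ => hH')
  rwa [Fintype.sum_unique] at h

end Literature.InformationTheory.Entanglement.NegativityLocalMonotone
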